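import Mathlib
import HarnessLib
import Summits.Ventures.LatticeQCDFlow.Scoring.GreenKuboDegenerateMoments
import Summits.Ventures.LatticeQCDFlow.Scoring.GreenKuboDegenerateReversible

/-!
# The leading-bias constant in the degenerate case: `σ²_f = 0 ⇒ Γ_f = −Var_π(h) ≤ 0`, with equality
# iff `f̄ = 0` a.e.; the TRICHOTOMY `f̄ = 0 a.e.` / `σ²_f = 0, Γ_f < 0` / `σ²_f > 0`

HONEST FRAMING: exact (Metropolis-corrected) sampling algorithms for lattice gauge theory;
figures of merit are autocorrelation/cost numbers at stated couplings and volumes; no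
continuum-physics claim.

Venture `LatticeQCDFlow` (cell pub-lqcd), topic `Scoring`; FANOUT row 8 (`s0-cpn-nemc`, GEN-23).
NEW WORK of the cell, not a published result; no definition is introduced; nothing is cited as a
fact.  Setting: the geometric sup-norm envelope `|(kop κ)^[t] g − πg| ≤ 2 C_g A ρ^t` (`0 ≤ ρ < 1`), `π`
invariant, `|f| ≤ C` measurable, `f̄ = f − πf`, `σ²_f = ∫ f̄² dπ + 2 Σ' k, γ_{k+1}` and
`Γ_f = Σ' k, (k+1) γ_{k+1}` (`γ_k = ∫ f̄ (kop κ)^[k] f̄ dπ`) — `Γ_f` is the leading-bias constant of the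
batch-means error bar: `E[σ̂²_{a,b}] = σ²_f − 2 Γ_f (a+1)/(ab) + O(1/(ab) + ρ^{b+1}/b)`
(`Scoring/BatchMeansBiasLeading`) and `E_{μ₀}[S_{s,n}²] − n σ²_f → −2 Γ_f`
(`Scoring/GeometricEnvelopeBlockSumLeadingBias`).  In the degenerate case `σ²_f = 0`,
`Scoring/GreenKuboDegenerateMoments` gives `E_π[S_{n,n}²] → 2 Var_π(h)` for every bounded measurable
Poisson solution `h` (`h − kop κ h = f̄`); comparing the two limits along the diagonal `(n, n) → ∞`:
**`Γ_f = −Var_π(h) = −(∫ h² dπ − (∫ h dπ)²) ≤ 0`** — the same number for every bounded Poisson solution.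
`Γ_f = 0` then forces `Var_π(h) = 0`, i.e. `h = πh` `π`-a.e., and by invariance `kop κ h = πh` `π`-a.e.,
so `f̄ = h − kop κ h = 0` `π`-a.e.; conversely `f̄ = 0` a.e. kills every `γ_k`, hence `σ²_f = Γ_f = 0`.
THE TRICHOTOMY: for a bounded observable EXACTLY ONE of — (a) `f̄ = 0` `π`-a.e. (nothing to estimate;
`σ²_f = Γ_f = 0`); (b) `σ²_f = 0`, `Γ_f = −Var_π(h) < 0` (a genuine coboundary: the CLT is degenerate, the
centred partial sums stay bounded, and the batch-means estimator has mean `2 Var_π(h) (a+1)/(ab) + O(…)`,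
positive at order `1/b` although `σ²_f = 0`); (c) `σ²_f > 0` (the regime of all the row's studentised
CLTs).  Row 13's three-state example (`Exactness/NCMCGeneralSpaceAsymptoticVarianceCounterexample`:
`h = (0,1,1)`, `f = h − κh`, uniform `π`) is case (b) with `Γ_f = −Var_π(h) = −2/9`.  Printed
counterparts NAMED ONLY: the null-variance case for `V`-uniformly ergodic chains (Meyn–Tweedie Thm
17.5.4); bias expansions of non-overlapping batch means (Goldsman–Meketon 1986; Song–Schmeiser 1995;
Flegal–Jones 2010 §2) — nothing is cited as a fact.

## Content (envelope `(A, ρ)`, `0 ≤ ρ < 1`, `π` invariant; `|f| ≤ C` measurable; `σ²_f`, `Γ_f` written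
## out as integrals and series)

* **`leadingBias_eq_neg_variance_of_greenKubo_eq_zero`** — `σ²_f = 0 ⇒ Γ_f = −(∫ h² dπ − (∫ h dπ)²)`
  for every bounded measurable `h` with `h − kop κ h = f̄`;
* `leadingBias_nonpos_of_greenKubo_eq_zero` — `σ²_f = 0 ⇒ Γ_f ≤ 0`;
* (from `Scoring/GreenKuboDegenerateReversible`: `f̄ =ᵐ[π] 0 ⇒ σ²_f = 0`, `Γ_f = 0`);
* **`centred_ae_eq_zero_of_greenKubo_eq_zero_of_leadingBias_eq_zero`** — `σ²_f = 0 ⇒ Γ_f = 0 ⇒ f̄ =ᵐ[π] 0`;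
* **`greenKubo_leadingBias_trichotomy_of_envelope`** — (a) ∨ (b) ∨ (c) as above (mutually exclusive by
  construction: (a) has `Γ_f = 0`, (b) has `Γ_f < 0`, (c) has `σ²_f > 0`).

NOT CLAIMED: the sign of `Γ_f` when `σ²_f > 0` (positive for positive kernels,
`Scoring/PositiveKernelBatchMeansBias`; either sign in general); reversible kernels; unbounded
observables; any `A, ρ` of a concrete sampler; any number of ours.
-/

noncomputable section

namespace Summit.Ventures.LatticeQCDFlow.Scoring

open MeasureTheory ProbabilityTheory Filter Finset Preorder Literature.Probability.MarkovChains
open scoped ENNReal Topology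

variable {Ω : Type*} [MeasurableSpace Ω]

section Envelope

variable {κ : Kernel Ω Ω} [IsMarkovKernel κ] {π : Measure Ω} [IsProbabilityMeasure π] {A ρ : ℝ}

/-! ### The leading-bias constant in the degenerate case: `Γ_f = −Var_π(h)` -/

/-- **`σ²_f = 0 ⇒ Γ_f = −Var_π(h)`**: under the envelope with `π` invariant (`0 ≤ ρ < 1`), `|f| ≤ C`
measurable, for EVERY bounded measurable Poisson solution `h` (`h − kop κ h = f − πf`):
`Σ' k, (k+1) ∫ f̄ (kop κ)^[k+1] f̄ dπ = −(∫ h² dπ − (∫ h dπ)²)`. -/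
theorem leadingBias_eq_neg_variance_of_greenKubo_eq_zero (hπ : Kernel.Invariant κ π)
    (henv : ∀ (g : Ω → ℝ), Measurable g → ∀ (Cg : ℝ), (∀ x, |g x| ≤ Cg) →
      ∀ (t : ℕ) (x : Ω), |(kop κ)^[t] g x - ∫ y, g y ∂π| ≤ 2 * Cg * (A * ρ ^ t))
    (hρ0 : 0 ≤ ρ) (hρ1 : ρ < 1)
    {f : Ω → ℝ} (hf : Measurable f) {C : ℝ} (hC : ∀ x, |f x| ≤ C)
    {h : Ω → ℝ} (hh : Measurable h) {Ch : ℝ} (hCh : ∀ x, |h x| ≤ Ch)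
    (hpois : ∀ y, h y - kop κ h y = f y - ∫ z, f z ∂π)
    (hσ : (∫ y, (f y - ∫ z, f z ∂π) ^ 2 ∂π)
        + 2 * ∑' k, ∫ y, (f y - ∫ z, f z ∂π) * (kop κ)^[k + 1] (fun y => f y - ∫ z, f z ∂π) y ∂π
        = 0) :
    ∑' k : ℕ, ((k : ℝ) + 1)
        * ∫ y, (f y - ∫ z, f z ∂π) * (kop κ)^[k + 1] (fun y => f y - ∫ z, f z ∂π) y ∂π
      = -(∫ y, h y ^ 2 ∂π - (∫ y, h y ∂π) ^ 2) := by
  set Γ : ℝ := ∑' k : ℕ, ((k : ℝ) + 1)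
      * ∫ y, (f y - ∫ z, f z ∂π) * (kop κ)^[k + 1] (fun y => f y - ∫ z, f z ∂π) y ∂π with hΓ
  set E : ℕ × ℕ → ℝ := fun sn =>
    ∫ x, (∑ t ∈ Finset.range sn.2, (f (x (sn.1 + t)) - ∫ z, f z ∂π)) ^ 2
      ∂(Kernel.trajMeasure (X := fun _ : ℕ => Ω) π
        (fun n : ℕ => κ.comap (fun h : (i : ↥(Finset.Iic n)) → Ω => h ⟨n, Finset.mem_Iic.2 le_rfl⟩)
          (measurable_pi_apply _))) with hE
  -- (198): `E(s,n) − n σ² → −2Γ` along `atTop` on `ℕ × ℕ`; with `σ² = 0` and along the diagonal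
  have h198 := tendsto_chain_blockSum_sq_sub_linear_of_envelope π henv hρ0 hρ1 hf hC
  rw [hσ, ← hΓ] at h198
  have hdiag : Tendsto (fun n : ℕ => E (n, n)) atTop (𝓝 (-(2 * Γ))) := by
    have := h198.comp tendsto_atTop_diagonal
    refine this.congr fun n => ?_
    simp only [Function.comp_apply, hE, mul_zero, sub_zero]
  -- `Scoring/GreenKuboDegenerateMoments`: `E(n,n) = 2(∫h² − ∫ h Kⁿ h) → 2 Var_π(h)`
  have hdiag' : Tendsto (fun n : ℕ => E (n, n)) atTop
      (𝓝 (2 * (∫ y, h y ^ 2 ∂π - (∫ y, h y ∂π) ^ 2))) := by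
    refine (((tendsto_integral_mul_iterate_kop_of_envelope (κ := κ) henv hρ0 hρ1 hh hCh).const_sub
      _).const_mul 2).congr fun n => ?_
    rw [hE]
    exact (chain_blockSum_sq_eq_of_greenKubo_eq_zero hπ henv hρ0 hρ1 hf hC hh hCh hpois hσ n n).symm
  have huniq := tendsto_nhds_unique hdiag hdiag'
  linarith

/-- **`σ²_f = 0 ⇒ Γ_f ≤ 0`.** -/
theorem leadingBias_nonpos_of_greenKubo_eq_zero (hπ : Kernel.Invariant κ π)
    (henv : ∀ (g : Ω → ℝ), Measurable g → ∀ (Cg : ℝ), (∀ x, |g x| ≤ Cg) →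
      ∀ (t : ℕ) (x : Ω), |(kop κ)^[t] g x - ∫ y, g y ∂π| ≤ 2 * Cg * (A * ρ ^ t))
    (hρ0 : 0 ≤ ρ) (hρ1 : ρ < 1)
    {f : Ω → ℝ} (hf : Measurable f) {C : ℝ} (hC : ∀ x, |f x| ≤ C)
    (hσ : (∫ y, (f y - ∫ z, f z ∂π) ^ 2 ∂π)
        + 2 * ∑' k, ∫ y, (f y - ∫ z, f z ∂π) * (kop κ)^[k + 1] (fun y => f y - ∫ z, f z ∂π) y ∂π
        = 0) :
    ∑' k : ℕ, ((k : ℝ) + 1)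
        * ∫ y, (f y - ∫ z, f z ∂π) * (kop κ)^[k + 1] (fun y => f y - ∫ z, f z ∂π) y ∂π ≤ 0 := by
  obtain ⟨h, hh, hCh, hpois⟩ := poisson_exists_of_geometricEnvelope henv hρ0 hρ1 hf hC
  rw [leadingBias_eq_neg_variance_of_greenKubo_eq_zero hπ henv hρ0 hρ1 hf hC hh hCh hpois hσ]
  linarith [sq_integral_le_integral_sq π hh hCh]

/-! ### The trichotomy -/

/-- **`σ²_f = 0` and `Γ_f = 0 ⇒ f̄ = 0` `π`-a.e.**: in the degenerate case a vanishing leading-bias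
constant means there was nothing to estimate (`Var_π(h) = 0`, so `h` and `kop κ h` are `π`-a.e. the
constant `πh`). -/
theorem centred_ae_eq_zero_of_greenKubo_eq_zero_of_leadingBias_eq_zero (hπ : Kernel.Invariant κ π)
    (henv : ∀ (g : Ω → ℝ), Measurable g → ∀ (Cg : ℝ), (∀ x, |g x| ≤ Cg) →
      ∀ (t : ℕ) (x : Ω), |(kop κ)^[t] g x - ∫ y, g y ∂π| ≤ 2 * Cg * (A * ρ ^ t))
    (hρ0 : 0 ≤ ρ) (hρ1 : ρ < 1)
    {f : Ω → ℝ} (hf : Measurable f) {C : ℝ} (hC : ∀ x, |f x| ≤ C)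
    (hσ : (∫ y, (f y - ∫ z, f z ∂π) ^ 2 ∂π)
        + 2 * ∑' k, ∫ y, (f y - ∫ z, f z ∂π) * (kop κ)^[k + 1] (fun y => f y - ∫ z, f z ∂π) y ∂π
        = 0)
    (hΓ : ∑' k : ℕ, ((k : ℝ) + 1)
        * ∫ y, (f y - ∫ z, f z ∂π) * (kop κ)^[k + 1] (fun y => f y - ∫ z, f z ∂π) y ∂π = 0) :
    (fun y => f y - ∫ z, f z ∂π) =ᵐ[π] 0 := by
  obtain ⟨h, hh, hCh', hpois⟩ := poisson_exists_of_geometricEnvelope henv hρ0 hρ1 hf hC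
  set Ch : ℝ := 4 * C * A / (1 - ρ) with hChdef
  have hCh : ∀ x, |h x| ≤ Ch := hCh'
  set m := ∫ y, h y ∂π with hm
  have hvar : ∫ y, h y ^ 2 ∂π - m ^ 2 = 0 := by
    have := leadingBias_eq_neg_variance_of_greenKubo_eq_zero hπ henv hρ0 hρ1 hf hC hh hCh hpois hσ
    rw [hΓ] at this
    linarith
  -- `∫ (h − m)² dπ = ∫ h² dπ − m² = 0`, so `h = m` a.e.
  have hi1 : Integrable h π := integrable_of_bounded π hh hCh
  have hi2 : Integrable (fun y => h y ^ 2) π :=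
    integrable_of_bounded π (hh.pow_const 2) (C := Ch ^ 2) fun y => by
      rw [abs_pow]; exact pow_le_pow_left₀ (abs_nonneg _) (hCh y) 2
  have hdev : ∫ y, (h y - m) ^ 2 ∂π = 0 := by
    have hexp : (fun y => (h y - m) ^ 2) = fun y => (h y ^ 2 - (2 * m) * h y) + m ^ 2 := by
      funext y; ring
    have hiB : Integrable (fun y => (2 * m) * h y) π := hi1.const_mul (2 * m)
    have hiA : Integrable (fun y => h y ^ 2 - (2 * m) * h y) π := hi2.sub hiB
    rw [hexp, integral_add hiA (integrable_const _), integral_sub hi2 hiB,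
      integral_const_mul, integral_const, probReal_univ, one_smul, ← hm]
    linarith
  have hCm : ∀ y, |h y - m| ≤ Ch + Ch := fun y => by
    have hmb : |m| ≤ Ch := by
      calc |m| = ‖∫ y, h y ∂π‖ := (Real.norm_eq_abs _).symm
        _ ≤ Ch * π.real Set.univ := norm_integral_le_of_norm_le_const (Eventually.of_forall fun y => by
            rw [Real.norm_eq_abs]; exact hCh y)
        _ = Ch := by rw [probReal_univ, mul_one]
    exact (abs_sub _ _).trans (add_le_add (hCh y) hmb)
  have hidev : Integrable (fun y => (h y - m) ^ 2) π :=
    integrable_of_bounded π ((hh.sub_const m).pow_const 2) (C := (Ch + Ch) ^ 2) fun y => by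
      rw [abs_pow]; exact pow_le_pow_left₀ (abs_nonneg _) (hCm y) 2
  have hae : (fun y => h y - m) =ᵐ[π] 0 :=
    ((integral_eq_zero_iff_of_nonneg (fun y => sq_nonneg _) hidev).1 hdev).mono fun y hy =>
      pow_eq_zero_iff two_ne_zero |>.1 hy
  -- `kop κ h − m = kop κ (h − m)` is a.e. zero too: `∫ |kop κ (h − m)| dπ ≤ ∫ kop κ |h − m| dπ = ∫ |h − m| dπ = 0`
  have hdm : Measurable fun y => h y - m := hh.sub_const m
  have habs_m : Measurable fun y => |h y - m| := hdm.abs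
  have habs_b : ∀ y, |(fun y => |h y - m|) y| ≤ Ch + Ch := fun y => by
    rw [abs_abs]; exact hCm y
  have hK : ∀ x, |kop κ h x - m| ≤ kop κ (fun y => |h y - m|) x := fun x => by
    have e : kop κ h x - m = ∫ y, (h y - m) ∂(κ x) := by
      unfold kop
      rw [integral_sub (integrable_of_bounded _ hh hCh) (integrable_const m), integral_const,
        probReal_univ, one_smul]
    rw [e]
    exact abs_integral_le_integral_abs
  have hint_abs : ∫ y, |h y - m| ∂π = 0 := by
    have e : ∫ y, |h y - m| ∂π = ∫ _y, (0 : ℝ) ∂π :=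
      integral_congr_ae (hae.mono fun y hy => by
        have hy' : h y - m = 0 := hy
        show |h y - m| = 0
        rw [hy', abs_zero])
    rw [e, integral_zero]
  have hKint : ∫ x, kop κ (fun y => |h y - m|) x ∂π = 0 := by
    rw [integral_kop κ hπ habs_m habs_b, hint_abs]
  have hKm_m : Measurable fun x => |kop κ h x - m| := ((measurable_kop κ hh).sub_const m).abs
  have hKi : Integrable (fun x => |kop κ h x - m|) π :=
    integrable_of_bounded π hKm_m (C := Ch + Ch) fun x => by
      rw [abs_abs]
      exact (hK x).trans ((le_abs_self _).trans (abs_kop_le κ habs_b x))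
  have hK0 : ∫ x, |kop κ h x - m| ∂π = 0 := by
    refine le_antisymm ?_ (integral_nonneg fun x => abs_nonneg _)
    calc ∫ x, |kop κ h x - m| ∂π ≤ ∫ x, kop κ (fun y => |h y - m|) x ∂π :=
          integral_mono hKi (integrable_of_bounded π (measurable_kop κ habs_m) (abs_kop_le κ habs_b)) hK
      _ = 0 := hKint
  have haeK : (fun x => |kop κ h x - m|) =ᵐ[π] 0 :=
    (integral_eq_zero_iff_of_nonneg (fun x => abs_nonneg _) hKi).1 hK0
  filter_upwards [hae, haeK] with y h1 h2
  have h1' : h y - m = 0 := h1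
  have h2' : kop κ h y - m = 0 := abs_eq_zero.1 h2
  show f y - ∫ z, f z ∂π = (0 : Ω → ℝ) y
  rw [← hpois y, Pi.zero_apply]
  linarith

/-- **THE TRICHOTOMY** for a bounded measurable observable under the envelope with `π` invariant
(`0 ≤ ρ < 1`): EITHER `f̄ = 0` `π`-a.e. (then `σ²_f = 0` and `Γ_f = 0`), OR `σ²_f = 0` with `Γ_f < 0` and
`f̄ ≠ 0` on a set of positive `π`-measure (a genuine coboundary: degenerate CLT, bounded centred sums,
batch means biased UP at order `1/b`), OR `σ²_f > 0`. -/
theorem greenKubo_leadingBias_trichotomy_of_envelope (hπ : Kernel.Invariant κ π)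
    (henv : ∀ (g : Ω → ℝ), Measurable g → ∀ (Cg : ℝ), (∀ x, |g x| ≤ Cg) →
      ∀ (t : ℕ) (x : Ω), |(kop κ)^[t] g x - ∫ y, g y ∂π| ≤ 2 * Cg * (A * ρ ^ t))
    (hρ0 : 0 ≤ ρ) (hρ1 : ρ < 1)
    {f : Ω → ℝ} (hf : Measurable f) {C : ℝ} (hC : ∀ x, |f x| ≤ C) :
    ((fun y => f y - ∫ z, f z ∂π) =ᵐ[π] 0
      ∧ (∫ y, (f y - ∫ z, f z ∂π) ^ 2 ∂π)
          + 2 * ∑' k, ∫ y, (f y - ∫ z, f z ∂π) * (kop κ)^[k + 1] (fun y => f y - ∫ z, f z ∂π) y ∂π = 0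
      ∧ ∑' k : ℕ, ((k : ℝ) + 1)
          * ∫ y, (f y - ∫ z, f z ∂π) * (kop κ)^[k + 1] (fun y => f y - ∫ z, f z ∂π) y ∂π = 0)
    ∨ ((∫ y, (f y - ∫ z, f z ∂π) ^ 2 ∂π)
          + 2 * ∑' k, ∫ y, (f y - ∫ z, f z ∂π) * (kop κ)^[k + 1] (fun y => f y - ∫ z, f z ∂π) y ∂π = 0
      ∧ ∑' k : ℕ, ((k : ℝ) + 1)
          * ∫ y, (f y - ∫ z, f z ∂π) * (kop κ)^[k + 1] (fun y => f y - ∫ z, f z ∂π) y ∂π < 0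
      ∧ ¬ ((fun y => f y - ∫ z, f z ∂π) =ᵐ[π] 0))
    ∨ 0 < (∫ y, (f y - ∫ z, f z ∂π) ^ 2 ∂π)
          + 2 * ∑' k, ∫ y, (f y - ∫ z, f z ∂π) * (kop κ)^[k + 1] (fun y => f y - ∫ z, f z ∂π) y ∂π := by
  rcases (greenKubo_nonneg_of_envelope hπ henv hρ0 hρ1 hf hC).eq_or_lt with h0 | hpos
  · have hσ := h0.symm
    rcases (leadingBias_nonpos_of_greenKubo_eq_zero hπ henv hρ0 hρ1 hf hC hσ).eq_or_lt with hΓ | hΓ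
    · exact Or.inl ⟨centred_ae_eq_zero_of_greenKubo_eq_zero_of_leadingBias_eq_zero hπ henv hρ0 hρ1
        hf hC hσ hΓ, hσ, hΓ⟩
    · refine Or.inr (Or.inl ⟨hσ, hΓ, fun hae => ?_⟩)
      have := leadingBias_eq_zero_of_centred_ae_eq_zero (κ := κ) (π := π) hae
      linarith
  · exact Or.inr (Or.inr hpos)

end Envelope

end Summit.Ventures.LatticeQCDFlow.Scoring

end
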